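import Mathlib.Geometry.Manifold.IntegralCurve.Basic
import Literature.Geometry.Lorentzian.KomarIntegral
import Literature.Geometry.Lorentzian.GeodesicSpeed
import Literature.Geometry.Lorentzian.SecondFundamentalFormApply
import Literature.Geometry.Lorentzian.DivergenceTheorem
import Literature.Geometry.Lorentzian.KillingDefect
import Literature.Geometry.Lorentzian.MetricNormSq
import HarnessLib

/-!
# Quasi-local angular momentum of a spacelike 2-surface and approximate Killing fields

Topic `Literature/Geometry/Lorentzian` (definition request `defn-Surface.quasiLocalAngularMomentum`
of route `FinalStateConjecture/PenroseDeficitNorm`, D2, for its crux K3 `KerrSaturatingConeMass`),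
written over the vocabulary of `TrappedSurface.lean` (`NullNormalPair`), `Hypersurface.lean`
(`normalDerivAlong`, `inducedMetric`), `Volume.lean` (`riemannianVolume`), exactly as
`LorentzianMetric.hawkingMass` (`BondiMass.lean`) and `LorentzianMetric.komarIntegral`
(`KomarIntegral.lean`) are.

## Main definitions

* `LorentzianMetric.torsionForm g f P y v` — the **torsion** (connection `1`-form of the normal
  bundle in the null frame) of the null normal pair `P = (L, L̲)`, `g(L, L̲) = -2`, of `f : S → M`:
  `ζ(v) = ½ g(D_v L, L̲)` for `v ∈ T_y S` (Christodoulou–Klainerman 1993, Introduction, before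
  (1.0.23): `ζ_A = ½ ⟨D_{e_A} l, e_3⟩` for the null pair `e_4 = l`, `e_3 = l̲`, `⟨e_4, e_3⟩ = -2`).
* `LorentzianMetric.quasiLocalAngularMomentum g f hpb hf P φ` — the **quasi-local angular
  momentum** `J(S, φ) = (8π)⁻¹ ∫_S ζ(φ) dA` of the compact spacelike immersed surface `f` with
  respect to a vector field `φ` ON `S` (meant: a rotation field tangent to `S`), `dA` the area
  measure `riemannianVolume (f^* g) 2` of the induced metric. This is the generalized angular
  momentum of Ashtekar–Krishnan, Living Rev. Relativ. 7 (2004) 10, §4.2.1 and §5.1,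
  `J^{(φ)}_S = -(8πG)⁻¹ ∮_S K̄_{ab} φ^a R^b d²V` (`K̄_{ab} = ∇_a τ̂_b` the extrinsic curvature of a
  slice through `S` with future unit normal `τ̂`, `R` the outward unit normal of `S` in the slice,
  `ℓ = τ̂ + R`, `n = τ̂ - R`, `ℓ·n = -2`), equivalently Brown–York's `J = ∮_B √σ j_i φ^i`
  (Phys. Rev. D 47 (1993) 1407, (5.8)), the isolated-horizon angular momentum
  `J_Δ = -(8π)⁻¹ ∮_S ω_a φ^a ²ε` (Ashtekar–Krishnan §4.1.2; Dreyer–Krishnan–Shoemaker–Schnetter,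
  Phys. Rev. D 67 (2003) 024018, §2.3: `J_Δ = (8π)⁻¹ ∮_S φ^a R^b K_{ab} d²V` with the opposite sign
  convention `K_{ab} = -∇_a T_b`), and Szabados's two-surface observable
  `O[N] = -(8πG)⁻¹ ∮_S N^a A_a dS` (Living Rev. Relativ. 12 (2009) 4, (11.3)); see "Conventions".
* `PseudoRiemannianMetric.killingDefectNormSq γ μ φ = ∫ |𝓛_φ γ|²_γ dμ`,
  `PseudoRiemannianMetric.cookWhitingCharge γ μ φ = ∫ ½ R_γ γ(φ, φ) dμ` and the predicate
  `PseudoRiemannianMetric.IsApproximateKillingField γ μ φ` — Cook–Whiting's **approximate Killing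
  field** on a closed Riemannian `2`-manifold `(N, γ)` (Phys. Rev. D 76 (2007) 041501, §2): a `C¹`
  divergence-free vector field minimising the Killing energy among `C¹` divergence-free fields
  of the same normalising charge; and the normalisation predicate `HasClosedOrbitsOfPeriod φ T`
  (all integral curves `T`-periodic, `T` the least period of one of them; Dreyer et al. 2003,
  §3: "normalized by requiring its integral curves to have affine length `2π`").
  `LorentzianMetric.IsApproximateKillingFieldOn g f hpb hf φ` is the specialisation to a cut
  `(S, f^* g)` with its area measure.

## Conventions (signs and normalisations), and a dictionary

With `(L, L̲) = (τ̂ + R, τ̂ - R)` as above and `K̄(V, W) = g(∇_V τ̂, W)` (Wald's sign, as in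
`Hypersurface.lean`), for `V` tangent to `S`:
`ζ(V) = ½ g(∇_V(τ̂ + R), τ̂ - R) = ½ (-g(∇_V τ̂, R) + g(∇_V R, τ̂)) = -K̄(V, R)`
(`g(∇_V τ̂, τ̂) = g(∇_V R, R) = 0`, `g(∇_V R, τ̂) = -g(R, ∇_V τ̂)`), the computation printed in
Dreyer et al. 2003, §2.3 (before their final formula) and Ashtekar–Krishnan 2004, §5.1. Hence
`J(S, φ) = (8π)⁻¹ ∫ ζ(φ) dA = -(8π)⁻¹ ∮ K̄_{ab} φ^a R^b dA` is EXACTLY Ashtekar–Krishnan's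
`J^{(φ)}_S`, normalised ("the overall sign ensures compatibility with conventions normally used in
the asymptotically flat context", loc. cit. §4.2.1) so that the Kerr horizon with `φ = ∂_φ` has
`J = M a`. Dictionary: Szabados's normal-bundle connection `1`-form `A_e = Π_e^f (∇_f t_a) v^a`
(§4.1.2) is `A = -ζ`; on a non-expanding horizon with null normal `ℓ = L` the rotation `1`-form
`ω` (`V^a ∇_a ℓ^b = V^a ω_a ℓ^b`, Ashtekar–Krishnan §2.1.3) has `ω(V) = -ζ(V)` for `V` tangent to
the cut (`g(∇_V ℓ, n) = ω(V) g(ℓ, n) = -2 ω(V)`), so `J(S, φ) = -(8π)⁻¹ ∮ ω(φ) = J_Δ`;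
Christodoulou–Klainerman's `ζ_A` is `ζ` itself. ORIENTATION: `ζ`, hence `J`, changes sign under
the swap `L ↔ L̲` (`torsionForm_swap`, `quasiLocalAngularMomentum_swap`; as the Komar integral,
`komarIntegral_swap`, and unlike the Hawking mass) and under `φ ↦ -φ`
(`quasiLocalAngularMomentum_neg`). BOOST GAUGE: under `(L, L̲) ↦ (a L, a⁻¹ L̲)`, `a > 0`,
`ζ ↦ ζ + d log a`, so `J(S, φ)` is boost invariant iff `∫ φ(log a) dA = 0` for all `a`, i.e. iff
`φ` is divergence-free on `(S, f^* g)` (Ashtekar–Krishnan §4.2.1: "this ambiguity disappears if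
`φ^a` is divergence-free on `S`"; Szabados §11.1: `O[N]` is boost-gauge invariant by `δ_e N^e = 0`)
— whence the divergence-free clause of `IsApproximateKillingField`. KOMAR: if `Φ` is a Killing
field of `g` and the null normal `L` is invariant under its flow along `S` (`∇_{φ} L = ∇_L Φ` on
`S`, `φ = Φ|_S` tangent to `S`; e.g. the axial Killing field of Kerr and the canonical null frame of
an axisymmetric cut), then `ζ(φ) = -½ κ_Φ` pointwise and `J(S, φ) = -½ · komarIntegral(S; Φ)`
(`quasiLocalAngularMomentum_eq_neg_half_komarIntegral`): the factor `-½` is Komar's anomalous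
factor between Wald's (11.2.9) `M = -(8π)⁻¹ ∮ ε_{abcd} ∇^c ξ^d` (the normalisation of
`komarIntegral`, `+M` on Schwarzschild) and Ch. 11, Problem 6, `J = (16π)⁻¹ ∮ ε_{abcd} ∇^c ψ^d`
(`= M a` on Kerr, (12.3.9); Ashtekar–Krishnan §4.1.2: "if `φ^a` happens to be a space-time
Killing field in a neighborhood of `Δ`, then `J_Δ` agrees with the Komar integral").

## Design choices

* `torsionForm g f P y v` is the printed formula, a plain function of `v ∈ T_y S` built on the
  directional covariant derivative `normalDerivAlong` of `Hypersurface.lean` (no junk-free linear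
  structure is imposed, exactly as for `normalDerivAlong`); it IS linear in `v` at interior points
  because `L` is `C¹` (`torsionForm_add`, `torsionForm_smul`, from the frame formula
  `normalDerivAlong_eq` of `SecondFundamentalFormApply.lean`, packaged as
  `PseudoRiemannianMetric.exists_normalDerivAlong_eq_clm`). The integrand of
  `quasiLocalAngularMomentum` is `y ↦ ζ_y(φ y)`; the Bochner integral returns the junk value `0` for
  a non-integrable integrand (never the case for `C¹` data on a compact surface).
* `φ` is a vector field ON `S` (`φ y ∈ T_y S`), as in all the sources ("any vector field `φ̃^a`
  tangential to `S`", Ashtekar–Krishnan §5.1); an ambient field enters only through the Komar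
  comparison, where the (unverifiable here) tangency `df(φ) = Φ ∘ f` is part of the documented
  meaning of the hypothesis `∇_{φ} L = ∇_L Φ`, not of the algebra.
* The approximate-Killing predicate lives at the generality of a pseudo-Riemannian metric `γ` on a
  manifold `N` with a measure `μ` (intended: the induced Riemannian metric of a `2`-sphere cut and
  its area measure, `IsApproximateKillingFieldOn`), using the tree's `vectorDivergence`
  (`DivergenceTheorem.lean`), `deformationTensor = 𝓛_φ γ` (`KillingDefect.lean`), `normSq` and
  `scalarCurvature`. Cook–Whiting minimise `∮ S_{ij} S^{ij}` over `ξ = ε D v` at fixed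
  `∮ ½ R |ξ|²` (their Lagrange multiplier `Θ`, eq. (11)); for divergence-free `ξ` on a `2`-surface
  `𝓛_ξ γ = 2 S` ((8)), so `|𝓛_ξ γ|² = 4 S_{ij} S^{ij}` and the minimisers agree; on a `2`-sphere the
  divergence-free fields are exactly the `ξ = ε D v` ((7)). We record the MINIMISER ("best
  approximation in a least-squares sense", their abstract and §2); the Euler–Lagrange system
  (12)–(13) also has non-minimising critical points, which Cook–Whiting also report (§3) and which
  this predicate deliberately does not admit. Both functionals are quadratic, so the predicate is
  invariant under constant rescalings `φ ↦ c φ`, `c ≠ 0`: the SCALE is not fixed by it. Cook–Whiting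
  (end of §2) and Dreyer et al. (§3) fix the scale by "affine length `2π`" of the integral
  curves, which is orbit-independent only for genuine rotations (Dreyer et al.: "we only have to
  perform the normalization on one integral curve. This normalization is valid for rotational
  Killing vectors"); it is therefore kept as the separate predicate `HasClosedOrbitsOfPeriod φ (2π)`,
  to be conjoined by the user who wants it (for a non-Killing minimiser the orbits, level sets of
  `v`, have orbit-dependent periods, so conjoining it is a genuine restriction).
* Not vendored (no source proves them in this generality, or they are the route's own objects):
  the boost-transformation law as a theorem (needs the Leibniz rule for `normalDerivAlong` in the
  normal field), existence/smoothness of Cook–Whiting minimisers (elliptic theory), the Kerr value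
  `J = M a`, and the route's candidate functional `𝔪_K² = m_H² + 4π J²/|S|` (crux K3 itself).
  PROVED sanity statements: exact Killing fields of a Riemannian metric are approximate Killing
  fields (`IsKillingField.isApproximateKillingField`, from `killingDefectNormSq_nonneg`,
  `killingDefectNormSq_eq_zero_of_isKillingField` and `IsKillingField.vectorDivergence_eq_zero`), in
  particular on cuts (`isApproximateKillingFieldOn_of_isKillingField`).

## References

* A. Ashtekar, B. Krishnan, *Isolated and dynamical horizons and their applications*, Living Rev.
  Relativ. 7 (2004) 10, §2.1.3 (rotation `1`-form `ω_a`), §4.1.2 (`J_Δ = -(8π)⁻¹∮(ω_aφ^a) ²ε`,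
  relation to the Komar integral), §4.2.1 (generalized angular momentum
  `J^φ_S = -(8πG)⁻¹ ∮ K_{ab} φ^a r̂^b d²V`, balance law, divergence-free `φ`), §3.1
  (conventions: `K_{ab} = q_a^c q_b^d ∇_c τ̂_d`, `ℓ = τ̂ + r̂`, `n = τ̂ - r̂`, `ℓ^a n_a = -2`), §5.1
  (`J^{(φ)}_S = -(8πG)⁻¹ ∮ φ^a R^b K̄_{ab} d²V` from Cauchy data; any tangential, divergence-free
  `φ̃`). [AshtekarKrishnan2004]
* J. D. Brown, J. W. York, *Quasilocal energy and conserved charges derived from the gravitational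
  action*, Phys. Rev. D 47 (1993) 1407–1419, (4.1b) (`j_a`), (5.8) (`J = ∮_B √σ j_i φ^i`).
  [BrownYork1993]
* O. Dreyer, B. Krishnan, D. Shoemaker, E. Schnetter, *Introduction to isolated horizons in
  numerical relativity*, Phys. Rev. D 67 (2003) 024018, §2.3 (`φ^aω_a = φ^a R^b ∇_a T_b`,
  `J_Δ = (8π)⁻¹∮ φ^a R^b K_{ab} d²V` with `K_{ab} = -γ_a^cγ_b^d∇_cT_d`), §3 (Killing transport;
  normalisation by affine length `2π` of the integral curves). [DreyerEtAl2003]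
* G. B. Cook, B. F. Whiting, *Approximate Killing vectors on `S²`*, Phys. Rev. D 76 (2007)
  041501(R), §1, (1) (quasi-local spin), §2, (7)–(13) (approximate Killing vectors), §3
  (multiple solutions; normalisation). [CookWhiting2007]
* L. B. Szabados, *Quasi-local energy-momentum and angular momentum in general relativity*, Living
  Rev. Relativ. 12 (2009) 4, §4.1.2 (connection `1`-form `A_e` on the normal bundle, boost gauge),
  §11.1, (11.3) (`O[N^a] = -(8πG)⁻¹∮ N^a A_a dS`, boost-gauge invariance iff `δ_e N^e = 0`, relation
  to Brown–York and Komar). [Szabados2009]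
* D. Christodoulou, S. Klainerman, *The global nonlinear stability of the Minkowski space*,
  Princeton 1993, Introduction, before (1.0.23) (`χ_{AB}`, `ζ_A = ½⟨D_{e_A} l, e_3⟩`, `ω`).
  [ChristodoulouKlainerman1993]
* R. M. Wald, *General Relativity*, Chicago 1984, §11.2, (11.2.9) (Komar mass), Ch. 11, Problem 6
  (`J = (16π)⁻¹ ∮_S ε_{abcd} ∇^c ψ^d`, the factor `-½`), (12.3.9) (`= M a` on Kerr). [Wald1984GR]
-/

noncomputable section

open Bundle Set Function Filter Manifold MeasureTheory Real
open scoped ContDiff Topology ENNReal Manifold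

namespace Literature.Geometry.Lorentzian

variable {E : Type*} [NormedAddCommGroup E] [NormedSpace ℝ E] {H : Type*} [TopologicalSpace H]
  {I : ModelWithCorners ℝ E H} {M : Type*} [TopologicalSpace M] [ChartedSpace H M]

/-! ### Linearity of `v ↦ D_v ν` (packaging of `normalDerivAlong_eq`) -/

namespace PseudoRiemannianMetric

variable {E' : Type*} [NormedAddCommGroup E'] [NormedSpace ℝ E'] {H' : Type*}
  [TopologicalSpace H'] {I' : ModelWithCorners ℝ E' H'} {N : Type*} [TopologicalSpace N]
  [ChartedSpace H' N] [IsManifold I ∞ M] {n : ℕ∞ω} [FiniteDimensional ℝ E]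
  (g : PseudoRiemannianMetric I n E (TangentSpace I : M → Type _)) [g.HasLeviCivita]

/-- **`v ↦ D_v ν` is a continuous linear map.** At an interior point `y` of `N`, if the field `ν`
along `f : N → M` is differentiable at `y` as a map `N → TM`, there is a continuous linear map
`A : T_y N →L[ℝ] T_{f y} M` with `D_v ν = A v` for all `v` (read off from the frame formula
`normalDerivAlong_eq`: `D_v ν = ∑ᵢ d(sⁱ(ν))_y(v) sᵢ(f y) + ∑ᵢ sⁱ(ν y) ∇_{df_y v} sᵢ`).
O'Neill 1983, Ch. 4, Lemma 1 and Cor. 2 (1) (pp. 98–99: `D̄_V X` is `𝔉(M)`-linear in `V`).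
[cite: ONeill1983, Ch. 4, Lemma 1 and Cor. 2] -/
theorem exists_normalDerivAlong_eq_clm [IsManifold I' ∞ N] {f : N → M} {ν : NormalField I f}
    {y : N} (hy : I'.IsInteriorPoint y)
    (hν : MDifferentiableAt I' I.tangent
      (fun x ↦ (TotalSpace.mk' E (f x) (ν x) : TangentBundle I M)) y) :
    ∃ A : TangentSpace I' y →L[ℝ] TangentSpace I (f y),
      ∀ v, g.normalDerivAlong f ν y v = A v := by
  let ψ : Fin (Module.finrank ℝ E) → (TangentSpace I' y →L[ℝ] ℝ) := fun i ↦
    mfderiv I' 𝓘(ℝ, ℝ) (fun x ↦ (trivializationAt E (TangentSpace I : M → Type _)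
      (f y)).localFrame_coeff I (Module.finBasis ℝ E) i (f x) (ν x)) y
  refine ⟨∑ i, (ψ i).smulRight ((trivializationAt E (TangentSpace I : M → Type _)
        (f y)).localFrame (Module.finBasis ℝ E) i (f y)) +
      ∑ i, (trivializationAt E (TangentSpace I : M → Type _) (f y)).localFrame_coeff I
          (Module.finBasis ℝ E) i (f y) (ν y) •
        (g.leviCivita ((trivializationAt E (TangentSpace I : M → Type _) (f y)).localFrame
          (Module.finBasis ℝ E) i) (f y)).comp (mfderiv I' I f y), fun v ↦ ?_⟩
  rw [g.normalDerivAlong_eq hy hν v]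
  simp only [ψ, add_apply, FunLike.coe_sum, Finset.sum_apply,
    ContinuousLinearMap.smulRight_apply, smul_apply,
    ContinuousLinearMap.comp_apply]
  rfl

end PseudoRiemannianMetric

/-! ### The torsion of a null normal pair and the quasi-local angular momentum -/

namespace LorentzianMetric

variable {E'' : Type*} [NormedAddCommGroup E''] [NormedSpace ℝ E''] {H'' : Type*}
  [TopologicalSpace H''] {I'' : ModelWithCorners ℝ E'' H''} {S : Type*} [TopologicalSpace S]
  [ChartedSpace H'' S] [IsManifold I ∞ M] {n : ℕ∞ω}
  [FiniteDimensional ℝ E] [CompleteSpace E] [Fact (1 ≤ n)] [FiniteDimensional ℝ E'']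
  [IsManifold I'' ∞ S] [CompactSpace S] [T2Space S] [MeasurableSpace S] [BorelSpace S]
  (g : LorentzianMetric I n M) [g.HasLeviCivita] {τ : TimeOrientation g} (f : S → M)

/-- The **torsion** `ζ` of the map `f : S → M` (meant: a spacelike immersion of codimension two)
with respect to the null normal pair `P = (L, L̲)`, `g(L, L̲) = -2`: for `v ∈ T_y S`,
`ζ_y(v) = ½ g_{f y}(D_v L, L̲ y)`, where `D_v L = normalDerivAlong g f L y v` is the covariant
derivative of the field `L` along `f` in the direction `v` (`Hypersurface.lean`). This is the
connection `1`-form of the normal bundle of `S` in the null frame: Christodoulou–Klainerman 1993,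
Introduction (before (1.0.23)), `ζ_A = ½ ⟨D_{e_A} l, e_3⟩` for the null pair `e_4 = l`, `e_3 = l̲`,
`⟨e_4, e_3⟩ = -2`; it is MINUS Szabados's `A_e = Π_e^f (∇_f t_a) v^a` (Living Rev. Relativ. 12
(2009) 4, §4.1.2) and, on a non-expanding horizon with `ℓ = L`, minus the rotation `1`-form `ω_a`
of Ashtekar–Krishnan (Living Rev. Relativ. 7 (2004) 10, §2.1.3) restricted to the cut; with
`(L, L̲) = (τ̂ + R, τ̂ - R)` adapted to a slice, `ζ(V) = -K̄(V, R)` (module docstring). A plain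
function of `v` (linear at interior points, `torsionForm_add`/`torsionForm_smul`); under the boost
`(L, L̲) ↦ (aL, a⁻¹L̲)` it changes by `d log a`, under the swap `L ↔ L̲` by a sign
(`torsionForm_swap`). [cite: ChristodoulouKlainerman1993, Introduction, before (1.0.23)]
[cite: Szabados2009, §4.1.2] -/
def torsionForm (P : NullNormalPair I'' g τ f) (y : S) (v : TangentSpace I'' y) : ℝ :=
  (1 / 2) * g.val (f y) (g.normalDerivAlong f P.L y v) (P.Lbar y)

/-- The **quasi-local angular momentum** `J(S, φ) = (8π)⁻¹ ∫_S ζ(φ) dA` of the compact spacelike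
immersed surface `f : S → M` with null normal pair `P = (L, L̲)` (torsion `ζ = torsionForm g f P`),
with respect to the vector field `φ` on `S` (meant: a rotation field — an (approximate) Killing
field of `(S, f^* g)`, see `IsApproximateKillingFieldOn` — or at least a divergence-free field, for
boost-gauge invariance), `dA = riemannianVolume (f^* g) 2` the area measure of the induced metric,
exactly as in `hawkingMass` and `komarIntegral`. With `(L, L̲) = (τ̂ + R, τ̂ - R)` adapted to a
slice through `S` this is `-(8π)⁻¹ ∮_S K̄_{ab} φ^a R^b dA`, the generalized angular momentum
`J^{(φ)}_S` of Ashtekar–Krishnan (Living Rev. Relativ. 7 (2004) 10, §4.2.1 and §5.1; `= M a` on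
every cut of the Kerr horizon for `φ = ∂_φ`), Brown–York's `J = ∮ √σ j_i φ^i` (Phys. Rev. D 47
(1993) 1407, (5.8)), the isolated-horizon `J_Δ = -(8π)⁻¹ ∮ ω_a φ^a ²ε` (loc. cit. §4.1.2; Dreyer et
al., Phys. Rev. D 67 (2003) 024018, §2.3) and Szabados's `O[φ] = -(8πG)⁻¹ ∮ φ^a A_a dS` (Living
Rev. Relativ. 12 (2009) 4, (11.3)). Odd under `L ↔ L̲` and under `φ ↦ -φ`; equal to
`-½ · komarIntegral` of a Killing field `Φ` extending `φ` whose flow preserves `L`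
(`quasiLocalAngularMomentum_eq_neg_half_komarIntegral`). Junk value `0` for a non-integrable
integrand (Bochner integral). Meant for `dim S = 2`, `dim M = 4`.
[cite: AshtekarKrishnan2004, §4.2.1 and §5.1] [cite: BrownYork1993, (5.8)]
[cite: Szabados2009, §11.1, (11.3)] -/
def quasiLocalAngularMomentum (hpb : PseudoRiemannianMetric.contMDiff_pullbackBilin I M I'' S n)
    (hf : g.IsSpacelikeImmersion I'' f) (P : NullNormalPair I'' g τ f)
    (φ : Π y : S, TangentSpace I'' y) : ℝ :=
  (8 * π)⁻¹ *
    ∫ y, g.torsionForm f P y (φ y) ∂(riemannianVolume (g.inducedRiemannianMetric f hpb hf) 2)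

omit [CompleteSpace E] [Fact (1 ≤ n)] [FiniteDimensional ℝ E''] [IsManifold I'' ∞ S]
  [CompactSpace S] [T2Space S] [MeasurableSpace S] [BorelSpace S] in
/-- Unfolding lemma: `ζ_y(v) = ½ g(D_v L, L̲)`. [folklore] -/
theorem torsionForm_apply (P : NullNormalPair I'' g τ f) (y : S) (v : TangentSpace I'' y) :
    g.torsionForm f P y v = (1 / 2) * g.val (f y) (g.normalDerivAlong f P.L y v) (P.Lbar y) :=
  rfl

/-! #### Linearity in `v` -/

omit [CompleteSpace E] [Fact (1 ≤ n)] [FiniteDimensional ℝ E'']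
  [CompactSpace S] [T2Space S] [MeasurableSpace S] [BorelSpace S] in
/-- **The torsion is a `1`-form**: at an interior point `y` (every point if `S` is boundaryless),
`v ↦ ζ_y(v)` is given by a linear functional (the null normal `L` of a `NullNormalPair`
is `C¹`, so `v ↦ D_v L` is linear, `exists_normalDerivAlong_eq_clm`). O'Neill 1983, Ch. 4,
Lemma 1 and Cor. 2. [cite: ONeill1983, Ch. 4, Lemma 1 and Cor. 2] -/
theorem exists_torsionForm_eq_clm (P : NullNormalPair I'' g τ f) {y : S}
    (hy : I''.IsInteriorPoint y) :
    ∃ α : TangentSpace I'' y →ₗ[ℝ] ℝ, ∀ v, g.torsionForm f P y v = α v := by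
  obtain ⟨A, hA⟩ := g.exists_normalDerivAlong_eq_clm hy
    ((P.contMDiff_L y).mdifferentiableAt one_ne_zero)
  refine ⟨(1 / 2 : ℝ) • (g.flat (f y) (P.Lbar y) ∘ₗ
    (A : TangentSpace I'' y →ₗ[ℝ] TangentSpace I (f y))), fun v ↦ ?_⟩
  simp only [torsionForm, hA, LinearMap.smul_apply, LinearMap.comp_apply,
    PseudoRiemannianMetric.flat_apply, ContinuousLinearMap.coe_coe, smul_eq_mul]
  rw [g.symm]

omit [CompleteSpace E] [Fact (1 ≤ n)] [FiniteDimensional ℝ E'']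
  [CompactSpace S] [T2Space S] [MeasurableSpace S] [BorelSpace S] in
/-- Additivity of the torsion in the tangent vector (at interior points). [folklore] -/
theorem torsionForm_add (P : NullNormalPair I'' g τ f) {y : S} (hy : I''.IsInteriorPoint y)
    (v w : TangentSpace I'' y) :
    g.torsionForm f P y (v + w) = g.torsionForm f P y v + g.torsionForm f P y w := by
  obtain ⟨α, hα⟩ := g.exists_torsionForm_eq_clm f P hy
  simp only [hα, map_add]

omit [CompleteSpace E] [Fact (1 ≤ n)] [FiniteDimensional ℝ E'']
  [CompactSpace S] [T2Space S] [MeasurableSpace S] [BorelSpace S] in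
/-- Homogeneity of the torsion in the tangent vector (at interior points). [folklore] -/
theorem torsionForm_smul (P : NullNormalPair I'' g τ f) {y : S} (hy : I''.IsInteriorPoint y)
    (c : ℝ) (v : TangentSpace I'' y) :
    g.torsionForm f P y (c • v) = c * g.torsionForm f P y v := by
  obtain ⟨α, hα⟩ := g.exists_torsionForm_eq_clm f P hy
  simp only [hα, map_smul, smul_eq_mul]

omit [CompleteSpace E] [Fact (1 ≤ n)] [FiniteDimensional ℝ E'']
  [CompactSpace S] [T2Space S] [MeasurableSpace S] [BorelSpace S] in
/-- The torsion is odd in the tangent vector (at interior points). [folklore] -/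
theorem torsionForm_neg (P : NullNormalPair I'' g τ f) {y : S} (hy : I''.IsInteriorPoint y)
    (v : TangentSpace I'' y) :
    g.torsionForm f P y (-v) = -g.torsionForm f P y v := by
  rw [← neg_one_smul ℝ v, g.torsionForm_smul f P hy, neg_one_mul]

/-! #### Orientation: the swap `L ↔ L̲` -/

omit [FiniteDimensional ℝ E''] [CompactSpace S] [T2Space S] [MeasurableSpace S] [BorelSpace S] in
/-- **The torsion changes sign under the swap of the null normals**: `ζ_{(L̲, L)} = -ζ_{(L, L̲)}`
at interior points. Proof: `g(L, L̲) = -2` is constant along the chart-straight curve `c` with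
velocity `v`, so by metric compatibility of the Levi-Civita connection along `f ∘ c`
(`hasDerivAt_val_apply_along`) `0 = g(D_v L, L̲) + g(L, D_v L̲)`. Szabados 2009, §4.1.2 (the
connection `1`-form of the normal bundle is defined by the ordered pair of normals);
Ashtekar–Krishnan 2004, §4.2.1 ("the overall sign"). [cite: Szabados2009, §4.1.2] -/
theorem torsionForm_swap (P : NullNormalPair I'' g τ f) {y : S} (hy : I''.IsInteriorPoint y)
    (v : TangentSpace I'' y) :
    g.torsionForm f P.swap y v = -g.torsionForm f P y v := by
  have hc : MDifferentiableAt 𝓘(ℝ, ℝ) I'' (curveThrough I'' y v) 0 :=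
    mdifferentiableAt_curveThrough_zero hy v
  have hV : MDifferentiableAt 𝓘(ℝ, ℝ) I.tangent (fun t ↦ (TotalSpace.mk' E
      (f (curveThrough I'' y v t)) (P.L (curveThrough I'' y v t)) : TangentBundle I M)) 0 :=
    ((P.contMDiff_L _).mdifferentiableAt one_ne_zero).comp 0 hc
  have hW : MDifferentiableAt 𝓘(ℝ, ℝ) I.tangent (fun t ↦ (TotalSpace.mk' E
      (f (curveThrough I'' y v t)) (P.Lbar (curveThrough I'' y v t)) : TangentBundle I M)) 0 :=
    ((P.contMDiff_Lbar _).mdifferentiableAt one_ne_zero).comp 0 hc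
  have hcompat : g.IsCompatible g.leviCivita :=
    (PseudoRiemannianMetric.isLeviCivita_leviCivita_holds (g := g.toPseudoRiemannianMetric)).2
  have hd := g.hasDerivAt_val_apply_along hcompat hV hW
  have hconst := hd.congr_of_eventuallyEq (f₁ := fun _ : ℝ ↦ (-2 : ℝ))
    (Eventually.of_forall fun t ↦ (P.val_L_Lbar (curveThrough I'' y v t)).symm)
  have key := hconst.unique (hasDerivAt_const (0 : ℝ) (-2 : ℝ))
  rw [curveThrough_zero] at key
  have key' : g.val (f y) (g.normalDerivAlong f P.L y v) (P.Lbar y) +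
      g.val (f y) (P.L y) (g.normalDerivAlong f P.Lbar y v) = 0 := key
  simp only [torsionForm, NullNormalPair.swap]
  rw [g.symm (f y) (g.normalDerivAlong f P.Lbar y v) (P.L y)]
  linarith

/-- **The quasi-local angular momentum is odd under the swap `(L, L̲) ↦ (L̲, L)`** of the null
normal pair (orientation reversal of the normal bundle) on a boundaryless surface — as the Komar
integral (`komarIntegral_swap`) and in contrast with the Hawking mass (`hawkingMass_swap`).
Ashtekar–Krishnan 2004, §4.2.1. [cite: AshtekarKrishnan2004, §4.2.1] -/
theorem quasiLocalAngularMomentum_swap [BoundarylessManifold I'' S]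
    (hpb : PseudoRiemannianMetric.contMDiff_pullbackBilin I M I'' S n)
    (hf : g.IsSpacelikeImmersion I'' f) (P : NullNormalPair I'' g τ f)
    (φ : Π y : S, TangentSpace I'' y) :
    g.quasiLocalAngularMomentum f hpb hf P.swap φ = -g.quasiLocalAngularMomentum f hpb hf P φ := by
  have h : (fun y ↦ g.torsionForm f P.swap y (φ y)) = fun y ↦ -g.torsionForm f P y (φ y) :=
    funext fun y ↦ g.torsionForm_swap f P BoundarylessManifold.isInteriorPoint (φ y)
  simp only [quasiLocalAngularMomentum, h, integral_neg, mul_neg]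

omit [CompleteSpace E] [Fact (1 ≤ n)] in
/-- Reversing the rotation field reverses the angular momentum: `J(S, -φ) = -J(S, φ)` (on a
boundaryless surface). [folklore] -/
theorem quasiLocalAngularMomentum_neg [BoundarylessManifold I'' S]
    (hpb : PseudoRiemannianMetric.contMDiff_pullbackBilin I M I'' S n)
    (hf : g.IsSpacelikeImmersion I'' f) (P : NullNormalPair I'' g τ f)
    (φ : Π y : S, TangentSpace I'' y) :
    g.quasiLocalAngularMomentum f hpb hf P (-φ) = -g.quasiLocalAngularMomentum f hpb hf P φ := by
  have h : (fun y ↦ g.torsionForm f P y ((-φ) y)) = fun y ↦ -g.torsionForm f P y (φ y) :=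
    funext fun y ↦ by rw [Pi.neg_apply, g.torsionForm_neg f P BoundarylessManifold.isInteriorPoint]
  simp only [quasiLocalAngularMomentum, h, integral_neg, mul_neg]

omit [CompleteSpace E] [Fact (1 ≤ n)] in
/-- Constant rescalings of the rotation field rescale the angular momentum:
`J(S, c φ) = c J(S, φ)` (on a boundaryless surface) — the normalisation of `φ` matters
(Dreyer–Krishnan–Shoemaker–Schnetter 2003, §3; `HasClosedOrbitsOfPeriod`).
[cite: DreyerEtAl2003, §3] -/
theorem quasiLocalAngularMomentum_smul [BoundarylessManifold I'' S]
    (hpb : PseudoRiemannianMetric.contMDiff_pullbackBilin I M I'' S n)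
    (hf : g.IsSpacelikeImmersion I'' f) (P : NullNormalPair I'' g τ f) (c : ℝ)
    (φ : Π y : S, TangentSpace I'' y) :
    g.quasiLocalAngularMomentum f hpb hf P (c • φ) =
      c * g.quasiLocalAngularMomentum f hpb hf P φ := by
  have h : (fun y ↦ g.torsionForm f P y ((c • φ) y)) = fun y ↦ c * g.torsionForm f P y (φ y) :=
    funext fun y ↦ by
      rw [Pi.smul_apply, g.torsionForm_smul f P BoundarylessManifold.isInteriorPoint]
  simp only [quasiLocalAngularMomentum, h, integral_const_mul]
  ring

/-! #### Comparison with the Komar integral -/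

omit [CompleteSpace E] [Fact (1 ≤ n)] [FiniteDimensional ℝ E''] [IsManifold I'' ∞ S]
  [CompactSpace S] [T2Space S] [MeasurableSpace S] [BorelSpace S] in
/-- **Torsion versus Komar density for a symmetry.** Let `Φ` be a Killing field of `g` and suppose
the null normal `L` is invariant under the flow of `Φ` at the point: `D_v L = ∇_{L y} Φ` (for
`v ∈ T_y S` with `df_y v = Φ (f y)` this says `[Φ, L] = 0` along `S` — e.g. `Φ` the axial Killing
field of an axisymmetric spacetime, `S` a `Φ`-invariant cut with its `Φ`-invariant null frame).
Then `ζ_y(v) = ½ g(∇_L Φ, L̲) = -½ κ_Φ(y)`, where `κ_Φ = ½(g(∇_{L̲}Φ, L) - g(∇_L Φ, L̲))` is the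
Komar density (`komarDensity`; Killing's equation gives `κ_Φ = -g(∇_L Φ, L̲)`,
`komarDensity_eq_of_isKillingField`). Ashtekar–Krishnan 2004, §4.1.2 ("if `φ^a` happens to be a
space-time Killing field in a neighborhood of `Δ`, then `J_Δ` agrees with the Komar integral");
Szabados 2009, §11.1; Wald 1984, (11.2.9) and Ch. 11, Problem 6 (the factor `-½`).
[cite: AshtekarKrishnan2004, §4.1.2] [cite: Wald1984GR, §11.2, (11.2.9) and Ch. 11, Problem 6] -/
theorem torsionForm_eq_neg_half_komarDensity (P : NullNormalPair I'' g τ f)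
    {Φ : Π x : M, TangentSpace I x} (hΦ : g.IsKillingField Φ) {y : S} {v : TangentSpace I'' y}
    (h : g.normalDerivAlong f P.L y v = g.leviCivita Φ (f y) (P.L y)) :
    g.torsionForm f P y v = -(1 / 2) * g.komarDensity f P Φ y := by
  have hK := hΦ.2 (f y) (P.Lbar y) (P.L y)
  have hs : g.val (f y) (P.Lbar y) (g.leviCivita Φ (f y) (P.L y)) =
      g.val (f y) (g.leviCivita Φ (f y) (P.L y)) (P.Lbar y) := g.symm _ _ _
  rw [g.komarDensity_eq_of_isKillingField f P hΦ y, torsionForm, h]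
  linarith

omit [CompleteSpace E] [Fact (1 ≤ n)] in
/-- **`J(S, φ) = -½ · Komar(S; Φ)` for a symmetry.** If `Φ` is a Killing field of `g` whose flow
preserves the null normal `L` along `S` in the directions `φ` (`D_{φ y} L = ∇_{L y} Φ` for all
`y`; meant: `φ = Φ|_S` tangent to `S`), the quasi-local angular momentum of `S` with respect to `φ`
is `-½` times the Komar integral of `Φ` over `S` (normalised as in `komarIntegral`, i.e. Wald's
(11.2.9), `+M` for the static Killing field on Schwarzschild): Komar's anomalous factor between mass
and angular momentum, Wald 1984, (11.2.9) versus Ch. 11, Problem 6; Ashtekar–Krishnan 2004, §4.1.2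
and §4.2.1
("if `φ^a` happens to be the restriction of a space-time Killing field to `S`, then `J^φ_S` agrees
with the Komar integral"); Szabados 2009, §11.1. In particular `J = M a` on every such cut enclosing
the hole in Kerr `(M, a)` (Wald 1984, (12.3.9); not proved here).
[cite: AshtekarKrishnan2004, §4.1.2 and §4.2.1] [cite: Wald1984GR, Ch. 11, Problem 6 and (12.3.9)] -/
theorem quasiLocalAngularMomentum_eq_neg_half_komarIntegral
    (hpb : PseudoRiemannianMetric.contMDiff_pullbackBilin I M I'' S n)
    (hf : g.IsSpacelikeImmersion I'' f) (P : NullNormalPair I'' g τ f)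
    {Φ : Π x : M, TangentSpace I x} (hΦ : g.IsKillingField Φ) (φ : Π y : S, TangentSpace I'' y)
    (h : ∀ y, g.normalDerivAlong f P.L y (φ y) = g.leviCivita Φ (f y) (P.L y)) :
    g.quasiLocalAngularMomentum f hpb hf P φ = -(1 / 2) * g.komarIntegral f hpb hf P Φ := by
  have h' : (fun y ↦ g.torsionForm f P y (φ y)) = fun y ↦ -(1 / 2) * g.komarDensity f P Φ y :=
    funext fun y ↦ g.torsionForm_eq_neg_half_komarDensity f P hΦ (h y)
  simp only [quasiLocalAngularMomentum, komarIntegral, h', integral_const_mul]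
  ring

end LorentzianMetric

/-! ### The period normalisation of a rotation field -/

section Orbits

variable {E' : Type*} [NormedAddCommGroup E'] [NormedSpace ℝ E'] {H' : Type*}
  [TopologicalSpace H'] {I' : ModelWithCorners ℝ E' H'} {N : Type*} [TopologicalSpace N]
  [ChartedSpace H' N]

/-- The vector field `φ` on `N` **has closed orbits of period `T`**: every (global) integral curve
of `φ` is `T`-periodic, and `T` is the least positive period of at least one of them (so that the
normalisation is not shared by the multiples `k φ`, `k ≥ 2`). This is the normalisation of a
rotational (Killing) field used for the quasi-local angular momentum: Dreyer–Krishnan–Shoemaker–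
Schnetter 2003, §3 ("the Killing vector is normalized by requiring its integral curves to have
affine length `2π` (it can be shown that the integral curves must in fact be closed). Since we are
only free to rescale the Killing vector by an overall constant, we only have to perform the
normalization on one integral curve. This normalization is valid for rotational Killing
vectors"); Cook–Whiting 2007, end of §2 ("once it is normalized to have affine length `2π`").
Integral curves are Mathlib's `IsMIntegralCurve` (on a compact manifold every integral curve is
global; the constant curves at zeros of `φ` are integral curves and are trivially periodic).
Kept separate from `PseudoRiemannianMetric.IsApproximateKillingField` (module docstring, "Design
choices"). [cite: DreyerEtAl2003, §3] -/
def HasClosedOrbitsOfPeriod (φ : Π y : N, TangentSpace I' y) (T : ℝ) : Prop :=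
  (∀ c : ℝ → N, IsMIntegralCurve c φ → Function.Periodic c T) ∧
    ∃ c : ℝ → N, IsMIntegralCurve c φ ∧ ∀ T' : ℝ, 0 < T' → T' < T → ¬Function.Periodic c T'

/-- Every integral curve of a field with closed orbits of period `T` is `T`-periodic. [folklore] -/
theorem HasClosedOrbitsOfPeriod.periodic {φ : Π y : N, TangentSpace I' y} {T : ℝ}
    (h : HasClosedOrbitsOfPeriod φ T) {c : ℝ → N} (hc : IsMIntegralCurve c φ) :
    Function.Periodic c T :=
  h.1 c hc

end Orbits

/-! ### Approximate Killing fields (Cook–Whiting) -/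

namespace PseudoRiemannianMetric

variable {E' : Type*} [NormedAddCommGroup E'] [NormedSpace ℝ E'] {H' : Type*}
  [TopologicalSpace H'] {I' : ModelWithCorners ℝ E' H'} {N : Type*} [TopologicalSpace N]
  [ChartedSpace H' N] [IsManifold I' ∞ N] {n : ℕ∞ω} [FiniteDimensional ℝ E'] [CompleteSpace E']
  [Fact (1 ≤ n)] [MeasurableSpace N]
  (γ : PseudoRiemannianMetric I' n E' (TangentSpace I' : N → Type _)) [γ.HasLeviCivita]
  (μ : Measure N)

/-- The **squared `L²` norm of the Killing defect** ("Killing energy") `∫_N |𝓛_φ γ|²_γ dμ` of the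
vector field `φ` on `(N, γ)` with respect to the measure `μ` (meant: the Riemannian volume): the
squared `γ`-norm (`normSq`, `|π|² = π_{ij} π^{ij}`) of the deformation tensor (Killing defect,
`KillingDefect.lean`) `π = 𝓛_φ γ`, `π(V, W) = γ(∇_V φ, W) + γ(V, ∇_W φ)` (`deformationTensor`),
integrated. For a divergence-free `φ` on a `2`-surface,
`∇_i φ_j = L ε_{ij} + S_{ij}` with `S` symmetric trace-free (Cook–Whiting 2007, §2, (8)), so
`𝓛_φ γ = 2S` and this is `4 ∮ S_{ij} S^{ij}`, four times Cook–Whiting's functional ((10)); it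
vanishes for a Killing field (`killingDefectNormSq_eq_zero_of_isKillingField`). Junk value `0` for a
non-integrable integrand. [cite: CookWhiting2007, §2, (8) and (10)] -/
def killingDefectNormSq (φ : Π y : N, TangentSpace I' y) : ℝ :=
  ∫ y, γ.normSq y (γ.deformationTensor φ y).toLinearMap₁₂ ∂μ

/-- The **Cook–Whiting normalising charge** `∫_N ½ R_γ γ(φ, φ) dμ` of the vector field `φ` on
`(N, γ)` (`R_γ = scalarCurvature`, twice the Gauss curvature on a surface): the constraint
functional `∮ ½ R |ξ|²`, `|ξ|² = (D_i v)(D^i v)` for `ξ = ε D v`, whose Lagrange multiplier is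
Cook–Whiting's `Θ` in `𝓛 = S_{ij} S^{ij} + ½ R Θ (D_k v)(D^k v)` (2007, §2, (11): the minimisation
of `S_{ij} S^{ij}` is performed "in a way that is independent of the normalization of `ξ^i`").
On a round sphere of radius `r` it is `r⁻² ∮ |φ|²`. [cite: CookWhiting2007, §2, (11)] -/
def cookWhitingCharge (φ : Π y : N, TangentSpace I' y) : ℝ :=
  ∫ y, (1 / 2) * γ.scalarCurvature y * γ.val y (φ y) (φ y) ∂μ

/-- **Approximate Killing field** (Cook–Whiting, *Approximate Killing vectors on `S²`*, Phys.
Rev. D 76 (2007) 041501, §2). The vector field `φ` on `(N, γ)` (meant: a closed Riemannian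
`2`-sphere, e.g. a cut of a horizon or of a null cone with its induced metric, and `μ` its area
measure) is a best approximation to a Killing field in Cook–Whiting's least-squares sense: it is
`C¹`, **divergence-free** (`vectorDivergence`, their reduction (7) `ξ^i = ε^{ij} D_j v` — on a
`2`-sphere exactly the divergence-free fields; also the condition for boost-gauge invariance of the
angular momentum, Ashtekar–Krishnan 2004 §4.2.1, Szabados 2009 §11.1), and it **minimises the
Killing energy** `∫ |𝓛_φ γ|²` (`killingDefectNormSq`, `= 4∮ S_{ij}S^{ij}`, their (10)) among the
`C¹` divergence-free fields `ψ` with the same normalising charge `∫ ½ R_γ |ψ|²`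
(`cookWhitingCharge`, their (11)). The Euler–Lagrange equations are Cook–Whiting's elliptic
system (12)–(13), whose non-minimising solutions (also used in their §3) are NOT admitted here.
Invariant under `φ ↦ c φ`, `c ≠ 0` (both functionals are quadratic): the scale is fixed separately,
e.g. by `HasClosedOrbitsOfPeriod φ (2π)` (Dreyer et al. 2003, §3; Cook–Whiting, end of §2). A
Killing field of a Riemannian `γ` is an approximate Killing field
(`IsKillingField.isApproximateKillingField`). [cite: CookWhiting2007, §2, (7)–(13)] -/
structure IsApproximateKillingField (φ : Π y : N, TangentSpace I' y) : Prop where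
  /-- `φ` is `C¹` (as a section of `TN`). -/
  contMDiff : CMDiff 1 (T% φ)
  /-- `φ` is divergence-free: `div_γ φ = 0`. -/
  vectorDivergence_eq_zero (y : N) : γ.vectorDivergence φ y = 0
  /-- `φ` minimises the Killing energy among `C¹` divergence-free fields of the same charge. -/
  killingDefectNormSq_le (ψ : Π y : N, TangentSpace I' y) :
    CMDiff 1 (T% ψ) → (∀ y, γ.vectorDivergence ψ y = 0) →
      γ.cookWhitingCharge μ ψ = γ.cookWhitingCharge μ φ →
        γ.killingDefectNormSq μ φ ≤ γ.killingDefectNormSq μ ψ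

omit [CompleteSpace E'] [Fact (1 ≤ n)] in
/-- **A Killing field has Killing energy zero** (`𝓛_φ γ = 0`, O'Neill 1983, Ch. 9, Prop. 9.25;
`isKillingField_iff_deformationTensor_eq_zero`). [cite: ONeill1983, Ch. 9, Prop. 9.25] -/
theorem killingDefectNormSq_eq_zero_of_isKillingField {φ : Π y : N, TangentSpace I' y}
    (h : γ.IsKillingField φ) : γ.killingDefectNormSq μ φ = 0 := by
  have h0 : ∀ y, (γ.deformationTensor φ y).toLinearMap₁₂ = 0 := fun y ↦ by
    rw [h.deformationTensor_eq_zero y]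
    ext v w
    simp
  simp [killingDefectNormSq, h0]

omit [CompleteSpace E'] [Fact (1 ≤ n)] in
/-- **The Killing energy of a Riemannian metric is nonnegative** (`|π|²_γ ≥ 0` pointwise for a
positive definite `γ`, `normSq_nonneg` of `MetricNormSq.lean`). [folklore] -/
theorem killingDefectNormSq_nonneg (hγ : γ.IsRiemannian) (φ : Π y : N, TangentSpace I' y) :
    0 ≤ γ.killingDefectNormSq μ φ :=
  integral_nonneg fun y ↦ γ.normSq_nonneg y hγ _

omit [CompleteSpace E'] [Fact (1 ≤ n)] [MeasurableSpace N] in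
/-- **A Killing field is divergence-free**: `div φ = tr ∇φ = 0` since `∇φ` is `γ`-skew
(Killing's equation; the trace of a skew-adjoint endomorphism vanishes: `tr A = tr (♭ A ♯) =
tr (-Aᵗ) = -tr A`). O'Neill 1983, Ch. 9, Prop. 9.25; Ashtekar–Krishnan 2004, §5.1 (a rotational
Killing field "has to Lie-drag only the area `2`-form" for the angular momentum formula).
[cite: ONeill1983, Ch. 9, Prop. 9.25] -/
theorem IsKillingField.vectorDivergence_eq_zero {φ : Π y : N, TangentSpace I' y}
    (h : γ.IsKillingField φ) (y : N) : γ.vectorDivergence φ y = 0 := by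
  haveI : Module.Finite ℝ (TangentSpace I' y) := inferInstanceAs (Module.Finite ℝ E')
  haveI : Module.Free ℝ (TangentSpace I' y) := inferInstanceAs (Module.Free ℝ E')
  rw [vectorDivergence_def]
  set A : TangentSpace I' y →ₗ[ℝ] TangentSpace I' y :=
    (γ.leviCivita φ y : TangentSpace I' y →ₗ[ℝ] TangentSpace I' y) with hA
  -- Killing's equation: `♭ ∘ A = -(Aᵗ ∘ ♭)`
  have hskew : γ.flat y ∘ₗ A = -(A.dualMap ∘ₗ γ.flat y) := by
    refine LinearMap.ext fun v ↦ LinearMap.ext fun w ↦ ?_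
    have := h.2 y v w
    simp only [LinearMap.comp_apply, flat_apply, LinearMap.neg_apply, LinearMap.dualMap_apply, hA,
      ContinuousLinearMap.coe_coe]
    linarith
  -- `A = ♯ ∘ (♭ ∘ A)` and `(♭ ∘ A) ∘ ♯ = -Aᵗ`
  have h1 : A = (γ.sharp y).toLinearMap ∘ₗ (γ.flat y ∘ₗ A) :=
    LinearMap.ext fun v ↦ by simp
  have h3 : (γ.flat y ∘ₗ A) ∘ₗ (γ.sharp y).toLinearMap = -A.dualMap := by
    rw [hskew, LinearMap.neg_comp, LinearMap.comp_assoc]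
    congr 1
    exact LinearMap.ext fun α ↦ by simp
  -- `tr A = tr ((♭ ∘ A) ∘ ♯) = -tr Aᵗ = -tr A`
  have key : LinearMap.trace ℝ _ A = -LinearMap.trace ℝ _ A :=
    calc LinearMap.trace ℝ _ A
        = LinearMap.trace ℝ _ ((γ.sharp y).toLinearMap ∘ₗ (γ.flat y ∘ₗ A)) := by rw [← h1]
      _ = LinearMap.trace ℝ _ ((γ.flat y ∘ₗ A) ∘ₗ (γ.sharp y).toLinearMap) :=
          LinearMap.trace_comp_comm' _ _
      _ = LinearMap.trace ℝ _ (-A.dualMap) := by rw [h3]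
      _ = -LinearMap.trace ℝ _ A :=
          ((LinearMap.trace ℝ _).map_neg A.dualMap).trans
            (congrArg Neg.neg (LinearMap.trace_transpose' A))
  linarith

variable {γ} in
omit [CompleteSpace E'] in
/-- **An exact Killing field of a Riemannian metric is an approximate Killing field** (for any
measure): it is `C¹`, divergence-free (`IsKillingField.vectorDivergence_eq_zero`), and its Killing
energy `0` (`killingDefectNormSq_eq_zero_of_isKillingField`) is minimal
(`killingDefectNormSq_nonneg`).
Cook–Whiting 2007, §2 ("Eq. (12) is satisfied by a Killing vector `ξ^i` when `Θ = 0`") and §3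
(on an axisymmetric metric the method returns the Killing vector, with `S_{ij}S^{ij} = 0`).
[cite: CookWhiting2007, §2–§3] -/
theorem IsKillingField.isApproximateKillingField (hγ : γ.IsRiemannian)
    {φ : Π y : N, TangentSpace I' y} (h : γ.IsKillingField φ) :
    γ.IsApproximateKillingField μ φ where
  contMDiff := h.contMDiff.of_le Fact.out
  vectorDivergence_eq_zero := h.vectorDivergence_eq_zero
  killingDefectNormSq_le ψ _ _ _ := by
    rw [γ.killingDefectNormSq_eq_zero_of_isKillingField μ h]
    exact γ.killingDefectNormSq_nonneg μ hγ ψ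

omit [CompleteSpace E'] in
/-- Non-vacuity (and a caveat): the zero field is an approximate Killing field of every Riemannian
metric — the predicate does not fix the scale (module docstring); the period normalisation
`HasClosedOrbitsOfPeriod` excludes it. [folklore] -/
theorem isApproximateKillingField_zero (hγ : γ.IsRiemannian) :
    γ.IsApproximateKillingField μ (0 : Π y : N, TangentSpace I' y) :=
  (γ.isKillingField_zero).isApproximateKillingField μ hγ

variable {γ μ} in
omit [CompleteSpace E'] [Fact (1 ≤ n)] in
/-- An approximate Killing field is divergence-free (restated field). [folklore] -/
theorem IsApproximateKillingField.div_eq_zero {φ : Π y : N, TangentSpace I' y}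
    (h : γ.IsApproximateKillingField μ φ) (y : N) : γ.vectorDivergence φ y = 0 :=
  h.vectorDivergence_eq_zero y

end PseudoRiemannianMetric

/-! ### Approximate Killing fields on a cut of a spacetime -/

namespace LorentzianMetric

variable {E'' : Type*} [NormedAddCommGroup E''] [NormedSpace ℝ E''] {H'' : Type*}
  [TopologicalSpace H''] {I'' : ModelWithCorners ℝ E'' H''} {S : Type*} [TopologicalSpace S]
  [ChartedSpace H'' S] [IsManifold I ∞ M] {n : ℕ∞ω} [FiniteDimensional ℝ E'']
  [IsManifold I'' ∞ S] [CompactSpace S] [T2Space S] [MeasurableSpace S] [BorelSpace S]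
  (g : LorentzianMetric I n M) (f : S → M)

/-- **Approximate Killing field on a cut.** The vector field `φ` on the spacelike immersed surface
`f : S → M` (meant: a compact `2`-sphere cut) is an approximate Killing field of the induced
Riemannian metric `f^* g` (`inducedMetric`, under its standing Levi-Civita hypothesis) with respect
to its area measure `riemannianVolume (f^* g) 2`, in the sense of Cook–Whiting 2007, §2
(`PseudoRiemannianMetric.IsApproximateKillingField`): the rotation fields with respect to which the
quasi-local angular momentum `quasiLocalAngularMomentum` of a distorted cut is evaluated
(Cook–Whiting 2007, §1, (1); Ashtekar–Krishnan 2004, §5.1 and §8).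
[cite: CookWhiting2007, §2] -/
def IsApproximateKillingFieldOn (hpb : PseudoRiemannianMetric.contMDiff_pullbackBilin I M I'' S n)
    (hf : g.IsSpacelikeImmersion I'' f) [(g.inducedMetric f hpb hf).HasLeviCivita]
    (φ : Π y : S, TangentSpace I'' y) : Prop :=
  (g.inducedMetric f hpb hf).IsApproximateKillingField
    (riemannianVolume (g.inducedRiemannianMetric f hpb hf) 2) φ

/-- Unfolding lemma for `IsApproximateKillingFieldOn`. [folklore] -/
theorem isApproximateKillingFieldOn_iff
    (hpb : PseudoRiemannianMetric.contMDiff_pullbackBilin I M I'' S n)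
    (hf : g.IsSpacelikeImmersion I'' f) [(g.inducedMetric f hpb hf).HasLeviCivita]
    (φ : Π y : S, TangentSpace I'' y) :
    g.IsApproximateKillingFieldOn f hpb hf φ ↔
      (g.inducedMetric f hpb hf).IsApproximateKillingField
        (riemannianVolume (g.inducedRiemannianMetric f hpb hf) 2) φ :=
  Iff.rfl

/-- **A Killing field of the induced metric of a cut is an approximate Killing field on it** (the
induced metric of a spacelike immersion is Riemannian, `isRiemannian_inducedMetric`). E.g. the
axial Killing field on any axisymmetric cut. Cook–Whiting 2007, §3.
[cite: CookWhiting2007, §3] -/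
theorem isApproximateKillingFieldOn_of_isKillingField [CompleteSpace E''] [Fact (1 ≤ n)]
    (hpb : PseudoRiemannianMetric.contMDiff_pullbackBilin I M I'' S n)
    (hf : g.IsSpacelikeImmersion I'' f) [(g.inducedMetric f hpb hf).HasLeviCivita]
    {φ : Π y : S, TangentSpace I'' y} (hφ : (g.inducedMetric f hpb hf).IsKillingField φ) :
    g.IsApproximateKillingFieldOn f hpb hf φ :=
  hφ.isApproximateKillingField _ (g.isRiemannian_inducedMetric f hpb hf)

end LorentzianMetric

end Literature.Geometry.Lorentzian

end
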